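import Summits.ABC.IUTFork.Thm311Real
import HarnessLib

/-!
# [IUTchIII] Theorem 3.11 over real definitions, DH: the indeterminacy groups (Ind1), (Ind2) at the Dupuy–Hilado level

Record-only file (D-0012) of the abc-iut cell (Cor. 3.12 sub-crew, wave-2 seat abc-iut-c312-5, board row
W2-A); TAKES NO SIDE on [IUTchIII] Cor. 3.12. `Thm311Real.lean` (p404777) instantiated abc-iut-c312-1's
`Thm311.LogShells` over the completions `K_v` with the two automorphism families of [IUTchIII] Thm. 3.11
(i) — `stripAut` (induced by isomorphisms of `D⊢`-prime-strips) and `ism` ("Ism") — left as BINDERS,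
because at the M level they are the content of the reconstruction interfaces. This file records, as a
SECOND, fully explicit instance, the reading of those two slots printed by Dupuy–Hilado
(arXiv:2004.13228, READ ON THE PAGE, §4.7 and §4.9):

* §4.7 "Formula for Ind1": "elements of Ind1 are just automorphisms of the finite dimensional
  `ℚ_p`-vector spaces `𝕃_p^{(j)}` induced by automorphisms of the `ℤ_p`-lattice …"; "We will call Ind1 the
  collection of all such permutations acting on `A^{⊗ j+1}_{V,p}`" (the strip isomorphisms being
  trivialised, §4.1 "Isomorphisms vs Automorphisms; trivializations") — so the STRIP part of c312-1's
  `LogShells.Ind1` is the identity: `Real.stripAutDH v := {1}`, and `Ind1 j` of the instance is EXACTLY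
  the set of capsule permutations `x_0 ⊗ ⋯ ⊗ x_j ↦ x_{σ⁻¹(0)} ⊗ ⋯ ⊗ x_{σ⁻¹(j)}`, one `σ` for all `v_ℚ`
  (`Real.mem_Ind1_logShellsDH_iff`, PROVED);
* §4.9 "`p`-adic Ind2": "These indeterminacies are referred to as “isometries” in [IUT2] … They act
  through the group `Aut_{ℚ_p}(K_v : I_v) = {φ ∈ Vect_{ℚ_p}(K_v, K_v) : φ(I_v) ⊂ I_v}`. Another way to see
  these are as `ℚ_p`-vector space automorphisms which arise as `ℤ_p`-lattice isomorphisms of `I_v`" — so at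
  a finite `v`, `Real.ismDH v :=` the bicontinuous `ℚ`-linear automorphisms `φ` of `K_v` with
  `φ(I_v) = I_v` (a continuous additive automorphism of the `ℚ_p`-vector space `K_v` is `ℚ_p`-linear; we
  phrase it over `ℚ` + continuity because Mathlib has no `ℚ_[p]`-algebra structure on
  `v.adicCompletion F` — see `Thm311Real2`'s residual note; DH print "`φ(I_v) ⊂ I_v`" and then say "lattice
  isomorphisms", so we take `φ(I_v) = I_v`); at an infinite `v`, where [IUTchIII] Thm. 3.11 (i) (Ind2) (p. 154 l. 59–60) /
  Prop. 1.2 (vii) let "copies of each of the automorphisms of order 2" act and DH treat only the `p`-adic case, `Real.ismDH v := {1, −1}` (the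
  sign automorphism of `K_v`).

CAVEAT ON THE BINDER `logv` (review notes R7-C5-N1, abc-iut-L6-t24, and abc-iut-c312-d1, 2026-08-25): `ismDH`
is DH's group — `ℤ_p`-lattice isomorphisms, hence Haar-measure preserving (DH §4.9 footnote; kernel:
abc-iut-c312-d1's `LogShellVolumeInvariance`, p406358) — exactly when `I_v` is a full lattice, e.g. when
`O_v ⊆ I_v` (abc-iut-L6-t3's `IntegersSubsetLogShell`, [IUTchIII] Rmk. 1.2.2 (i) (b^non)), which holds for the
ANALYTIC `p_v`-adic logarithm (abc-iut-S1's `unitLog`). The bare Π-type `PadicLogs F` also contains degenerate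
inhabitants (e.g. `0`, for which `I_v = {0}` and `ismDH` is every bicontinuous `ℚ`-linear automorphism, e.g.
`x ↦ p·x`, not volume-preserving). So at this level the binder `logv` still carries part of the content of (Ind2):
`Real.LogvLaw logv` (= `IntegersSubsetLogShell` at every finite place) names the law under which the DH reading is
the printed one, and `integers_subset_shell_of_law` records its first consequence; every `∀`/`∃` statement over
`ismDH` downstream should carry `LogvLaw logv` (or `logv :=` the analytic log) as a hypothesis.

RESIDUAL (neutral): this is the DH-LEVEL reading, cited as such; the M-level `Ism` ([IUTchII] Ex. 1.8 (iv),
`G_v`-isometries of `O^{×μ}`) and the automorphisms induced by isomorphisms of `G_v` ([AbsTopIII] Prop. 5.8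
(ii)) remain the binders of `Thm311Real.logShells` (owners abc-iut-L6-t1 / L4-t3 / L6-t3); at archimedean
`v` the FACTOR-WISE signs on `k~ = C~ × C~` ([AbsTopIII] Prop. 5.8 (v); L4-t3's `LogShells.lean`) are not
modelled by `{±1}` on `K_v` (→ abc-iut-L4-t3 · AbsTopIII:Prop5.8(v)). The `p_v`-adic logarithms stay the
binder `logv` (abc-iut-S1 `unitLog`, pending the `ℚ_[p]`-algebra instance) — WITH the caveat above: `LogvLaw logv`
(→ abc-iut-S1 · [AbsTopIII] Def. 5.4 (iii) / abc-iut-L6-t3 · IUTchIII:Rmk1.2.2(i) `IntegersSubsetLogShell`) is the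
hypothesis that makes `ismDH` the printed group.

NON-VACUITY (kernel-checked): `−1 ∈ Real.ismDH v` at every finite `v` (`neg_mem_ismDH_inr`: the log-shell
`(p_v^*)⁻¹·log_v(O_v^×)` is symmetric), so (Ind2) of this instance MOVES elements of the packets as soon
as `K_v ≠ 0`; whether it moves LOG-VOLUMES is `MRData.LogvolInvariant` (c312-1), a statement about Haar
measure under lattice isomorphisms (DH §4.9 footnote: "the distortion factor (the determinant) is 1";
abc-iut-c312-d1 p405779/p406358) — true under `LogvLaw logv`, false for degenerate `logv` (caveat above).

[cite: DupuyHilado2025, §4.7, §4.9] [claim: Mochizuki2012, status: disputed]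
typed ≠ discharged; instantiated ≠ endorsed.
-/

noncomputable section

namespace Summit.ABC.IUTFork.Thm311.Real

open NumberField IsDedekindDomain Literature.IUT.LogVolume Literature.IUT.LogThetaLattice

variable {F : Type} [Field F] [NumberField F] (X : PilotData F) (logv : PadicLogs F)

/-! ## 1. The two automorphism families at the Dupuy–Hilado level -/

/-- **(Ind1), strip part, DH level**: the identity only — Dupuy–Hilado §4.7 "We will call Ind1 the
collection of all such permutations" (isomorphisms of strips trivialised, §4.1).
[cite: DupuyHilado2025, §4.7] -/
def stripAutDH (x : Place F) : Set (Carrier x ≃ₗ[ℚ] Carrier x) := {LinearEquiv.refl ℚ (Carrier x)}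

/-- **(Ind2), DH level**: at a finite place `v`, Dupuy–Hilado §4.9 "`Aut_{ℚ_p}(K_v : I_v) = {φ ∈
Vect_{ℚ_p}(K_v, K_v) : φ(I_v) ⊂ I_v}` … `ℚ_p`-vector space automorphisms which arise as `ℤ_p`-lattice
isomorphisms of `I_v`" — the bicontinuous `ℚ`-linear automorphisms `φ` of `K_v` with `φ(I_v) = I_v` (= DH's
group when `I_v` is a full lattice, i.e. under `Real.LogvLaw logv` / for the analytic logarithm; see the module
docstring's CAVEAT); at an infinite place, the sign automorphisms `{1, −1}` of `K_v` ([IUTchIII] Thm. 3.11 (i) (Ind2), p. 154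
l. 59–60, and Prop. 1.2 (vii): "automorphisms of order 2"; DH treat the `p`-adic case only). [cite: DupuyHilado2025, §4.9] -/
def ismDH (logv : PadicLogs F) : ∀ x : Place F, Set (Carrier x ≃ₗ[ℚ] Carrier x)
  | .inl w => {LinearEquiv.refl ℚ (Carrier (.inl w)), LinearEquiv.neg ℚ}
  | .inr v => {φ | Continuous φ ∧ Continuous φ.symm ∧ φ '' shell logv (.inr v) = shell logv (.inr v)}

/-- The identity is a (trivialised) strip automorphism. [folklore] -/
theorem refl_mem_stripAutDH (x : Place F) : LinearEquiv.refl ℚ (Carrier x) ∈ stripAutDH x := rfl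

/-- The LAW on the binder `logv` under which the DH reading is the printed one: at every finite place
`O_v ⊆ I_v = (p_v^*)⁻¹·log_v(O_v^×)` — abc-iut-L6-t3's `IntegersSubsetLogShell` ([IUTchIII] Rmk. 1.2.2 (i)
(b^non): "the evident inclusions `O_k^▷ ⊆ O_k ⊆ I_k`"; for the analytic logarithm this is
`log(1 + p^*O) = p^*O`, [AbsTopIII] Def. 5.4 (iii)). It excludes the degenerate inhabitants of the Π-type
`PadicLogs F` (e.g. `0`). [claim: Mochizuki2012, status: disputed] -/
def LogvLaw (logv : PadicLogs F) : Prop :=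
  ∀ v : HeightOneSpectrum (𝓞 F), IntegersSubsetLogShell (integers v) (logv v) (residueChar F v)

/-- Under the law, `O_v ⊆ I_v` at every finite place: the log-shell is a full lattice (it contains the open
subring `O_v`), so `Real.ismDH` there consists of lattice isomorphisms of a genuine lattice (DH §4.9).
[claim: Mochizuki2012, status: disputed] -/
theorem integers_subset_shell_of_law {logv : PadicLogs F} (h : LogvLaw logv) (v : HeightOneSpectrum (𝓞 F)) :
    ((integers v : ValuationSubring (Carrier (.inr v : Place F))) : Set (Carrier (.inr v : Place F))) ⊆
      shell logv (.inr v) := by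
  rw [shell_inr]
  exact (h v).subset

/-- The identity is a lattice isomorphism / a sign. [folklore] -/
theorem refl_mem_ismDH (x : Place F) : LinearEquiv.refl ℚ (Carrier x) ∈ ismDH logv x := by
  cases x with
  | inl w => exact Or.inl rfl
  | inr v =>
    refine ⟨continuous_id, continuous_id, ?_⟩
    show (fun a => a) '' shell logv (.inr v) = shell logv (.inr v)
    exact Set.image_id' _

/-- At a finite place, an element of the DH (Ind2) group maps the log-shell onto itself ("`ℤ_p`-lattice
isomorphisms of `I_v`"). [cite: DupuyHilado2025, §4.9] -/
theorem image_shell_of_mem_ismDH {v : HeightOneSpectrum (𝓞 F)} {φ : Carrier (.inr v : Place F) ≃ₗ[ℚ] _}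
    (h : φ ∈ ismDH logv (.inr v)) : φ '' shell logv (.inr v) = shell logv (.inr v) := h.2.2

/-- The nonarchimedean log-shell `I_v = (p_v^*)⁻¹ · log_v(O_v^×)` is symmetric: `−I_v = I_v`
(`log_v(x⁻¹) = −log_v(x)`). [claim: Mochizuki2012, status: disputed] -/
theorem neg_mem_shell_inr (v : HeightOneSpectrum (𝓞 F)) {a : Carrier (.inr v : Place F)}
    (ha : a ∈ shell logv (.inr v)) : -a ∈ shell logv (.inr v) := by
  rw [shell_inr] at ha ⊢
  obtain ⟨x, rfl⟩ := ha
  refine ⟨x⁻¹, ?_⟩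
  rw [ofMul_inv, map_neg, mul_neg]

/-- **NON-VACUITY of (Ind2) at the DH level**: `−1 ∈ Ism_v` at every finite `v` (negation is bicontinuous,
`ℚ`-linear, and maps `I_v` onto itself). [cite: DupuyHilado2025, §4.9] -/
theorem neg_mem_ismDH_inr (v : HeightOneSpectrum (𝓞 F)) :
    LinearEquiv.neg ℚ ∈ ismDH logv (.inr v : Place F) := by
  refine ⟨continuous_neg, continuous_neg, ?_⟩
  ext a
  constructor
  · rintro ⟨b, hb, rfl⟩
    exact neg_mem_shell_inr logv v hb
  · intro ha
    exact ⟨-a, neg_mem_shell_inr logv v ha, neg_neg a⟩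

/-! ## 2. The DH-level log-shell instance and its (Ind1) -/

/-- **`Thm311.LogShells` INSTANTIATED AT THE DUPUY–HILADO LEVEL**: `Thm311Real.logShells` with the strip
automorphisms trivialised (`stripAutDH`) and Ism = the lattice isomorphisms of the log-shell (`ismDH`);
the only remaining binder is the family of `p_v`-adic logarithms `logv` (subject to `Real.LogvLaw`, module
docstring CAVEAT). From this instance abc-iut-c312-1's `LogShells.Ind1 j` / `Ind2 j v_ℚ` are Dupuy–Hilado's Ind1
(§4.7) and — under the law — Ind2 (§4.9) on `⨂_{i ≤ j} ⊕_{v|v_ℚ} K_v` (up to `⊗_ℚ` vs `⊗_{ℚ_p}`).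
[cite: DupuyHilado2025, §4.7, §4.9] -/
def logShellsDH : LogShells (thetaIndex X) :=
  logShells X logv stripAutDH (ismDH logv) refl_mem_stripAutDH (refl_mem_ismDH logv)

/-- The strip-automorphism slot of the DH instance is trivial. [cite: DupuyHilado2025, §4.7] -/
theorem logShellsDH_stripAut (x : Place F) :
    (logShellsDH X logv).stripAut x = {LinearEquiv.refl ℚ (Carrier x)} := rfl

/-- The Ism slot of the DH instance is `Real.ismDH`. [cite: DupuyHilado2025, §4.9] -/
theorem logShellsDH_ism (x : Place F) : (logShellsDH X logv).ism x = ismDH logv x := rfl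

/-- **(Ind1) of the DH instance = the capsule permutations** (Dupuy–Hilado §4.7: "elements of Ind1 are
just … permutations", "`x_0 ⊗ ⋯ ⊗ x_j ↦ x_{f_j⁻¹(j)} ⊗ ⋯ ⊗ x_{f_j⁻¹(0)}`", "the action of Ind1 on
`A^{⊗ j+1}_{V,p}` is simultaneous" in `p`): a family `Φ` lies in abc-iut-c312-1's `Ind1 j` for this instance
iff it is `v_ℚ ↦ permute σ` for ONE permutation `σ` of `S^±_{j+1}`. [cite: DupuyHilado2025, §4.7] -/
theorem mem_Ind1_logShellsDH_iff (j : (thetaIndex X).Label)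
    (Φ : ∀ vQ : RatPlace, (logShellsDH X logv).Packet j vQ ≃ₗ[ℚ] (logShellsDH X logv).Packet j vQ) :
    Φ ∈ (logShellsDH X logv).Ind1 j ↔
      ∃ σ : Equiv.Perm ((thetaIndex X).Caps j), ∀ vQ, Φ vQ = (logShellsDH X logv).permute j vQ σ := by
  constructor
  · rintro ⟨σ, h, hh, hΦ⟩
    refine ⟨σ, fun vQ => ?_⟩
    have hrefl : (fun i => (logShellsDH X logv).summandwise vQ
        fun v : (thetaIndex X).Fibre vQ => h i v.1) =
        fun _ => LinearEquiv.refl ℚ ((logShellsDH X logv).Packet1 vQ) := by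
      funext i
      have : (fun v : (thetaIndex X).Fibre vQ => h i v.1) =
          fun v : (thetaIndex X).Fibre vQ => LinearEquiv.refl ℚ ((logShellsDH X logv).carrier v.1) := by
        funext v; exact hh i v.1
      rw [this]
      exact (logShellsDH X logv).summandwise_refl vQ
    rw [hΦ vQ, hrefl, LogShells.factorwise_refl]
    rfl
  · rintro ⟨σ, hΦ⟩
    refine ⟨σ, fun _ v => LinearEquiv.refl ℚ _, fun _ _ => rfl, fun vQ => ?_⟩
    rw [hΦ vQ, LogShells.summandwise_refl_family, LogShells.factorwise_refl]
    rfl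

/-- (Ind1) of the DH instance acts on pure tensors by permuting the factors (c312-1's `permute_tprod`),
DH §4.7 display. [cite: DupuyHilado2025, §4.7] -/
theorem Ind1_logShellsDH_tprod {j : (thetaIndex X).Label}
    {Φ : ∀ vQ : RatPlace, (logShellsDH X logv).Packet j vQ ≃ₗ[ℚ] (logShellsDH X logv).Packet j vQ}
    (hΦ : Φ ∈ (logShellsDH X logv).Ind1 j) (vQ : RatPlace)
    (x : (thetaIndex X).Caps j → (logShellsDH X logv).Packet1 vQ) :
    ∃ σ : Equiv.Perm ((thetaIndex X).Caps j),
      Φ vQ ((logShellsDH X logv).tprod j vQ x) = (logShellsDH X logv).tprod j vQ (fun i => x (σ.symm i)) := by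
  obtain ⟨σ, h⟩ := (mem_Ind1_logShellsDH_iff X logv j Φ).mp hΦ
  exact ⟨σ, by rw [h vQ]; exact (logShellsDH X logv).permute_tprod j vQ σ x⟩

/-- **(Ind2) of the DH instance MOVES packet elements**: the family "`−1` on every summand of every factor"
lies in `Ind2 j v_ℚ` at every nonarchimedean `v_ℚ` (since `−1 ∈ Ism_v`), i.e. (Ind2) is not the trivial
group for this instance. [cite: DupuyHilado2025, §4.9] -/
theorem negFamily_mem_Ind2_logShellsDH (j : (thetaIndex X).Label) (p : Nat.Primes) :
    (logShellsDH X logv).factorwise j (.inr p)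
        (fun _ => (logShellsDH X logv).summandwise (.inr p) fun _ => LinearEquiv.neg ℚ) ∈
      (logShellsDH X logv).Ind2 j (.inr p) := by
  refine ⟨fun _ _ => LinearEquiv.neg ℚ, fun _ v => ?_, rfl⟩
  obtain ⟨x, hx⟩ := v
  rcases x with w | w
  · exact absurd hx (by simp [thetaIndex])
  · exact neg_mem_ismDH_inr logv w

end Summit.ABC.IUTFork.Thm311.Real

end
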